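import Summits.Ventures.PercRepro.RankLevelSetBiIndepMixedNormSkew

/-! # RankLevelSetBiIndepMixedNormSkewSharp — THE SHARP PER-SET LADDER: (CUM-norm) ON THE MINORS GIVES THE
(CUM-norm)-TYPE STATEMENT FOR EVERY MIXED PROFILE — `NormSkewBelow (q^{Y₁,Y₂}) (#E − #Y₂)`:
`q_i · C(#E − #Y₂, j) ≤ q_j · C(#E − #Y₂, i)` FOR `i < j`, `i + j + 1 ≤ #E − #Y₂` (night-1 g31; dossier §43.8)

`SkewConv.NormSkewBelow a N` is (CUM-norm)'s shape for a sequence: the comparisons normalized by `C(N, ·)` on the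
pairs `i + j + 1 ≤ N` (one short of `NormSkew a N`); it is a cone, monotone in `N`, `NormSkewBelow a (N + 1)`
implies `NormSkew a N` (the ratio lemma), and a shift by one adds two (`normSkewBelow_shift_one`, the same
binomial identities as `normSkew_shift_one`). THE SHARP INDUCTION (**`mixedCount_normSkewBelow_aux`**): under
(CUM-norm) on the minors of `M`, for every minor `N` and every `Y₁, Y₂ ⊆ E(N)` with `#Y₂ = b`:
`NormSkewBelow (q^{Y₁,Y₂}) (#E(N) − b)`, and `NormSkew (q^{∅,Y₂}) (#E(N) − b)` for `Y₁ = ∅`. Base `b = 0`: (CUM-norm)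
of `N` at `Y₁` shifted to the level index (`normSkewBelow_biContainCount_of_normSkew`), resp. Mono. Step at
`y ∈ Y₂` (`#Y₂ = b + 1`): the free part is the mixed family of `N ／ {y}` with `Y₂ ∖ {y}` (the same parameter
`#E − b − 1`); each absorbing fibre is a mixed family of `(N ／ {y}) ＼ {x}` (`NormSkewBelow`, parameter
`(#E − 2) − b`) shifted by one level — `NormSkewBelow (·) (#E − b)`, i.e. the FULL `NormSkew (·) (#E − b − 1)`
(`mixedAbsorb_normSkew_sharp`), the target at `b + 1`. COROLLARY (**`mixedCount_normSkewBelow`**): the (CUM-norm)-type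
statement (R) of dossier §43.8 for every mixed profile — at `Y₂ = ∅` it is (CUM-norm) itself (level index), at
`Y₁ = ∅` it is (AVOID-norm)_X; census-clean on every matroid with ≤ 8 elements and `#Y₁, #Y₂ ≤ 3` and on every
50th matroid on 9 elements (kit j319989). Every declaration has a docstring; imports: the cell's own modules and
Mathlib only. Axioms: standard. -/

namespace PercRepro

namespace SkewConv

open Finset

/-- **The (CUM-norm)-shaped normalized skew**: `a i · C(N, j) ≤ a j · C(N, i)` for `i < j`, `i + j + 1 ≤ N`. -/
def NormSkewBelow (a : ℕ → ℕ) (N : ℕ) : Prop :=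
  ∀ i j : ℕ, i < j → i + j + 1 ≤ N → a i * N.choose j ≤ a j * N.choose i

/-- `NormSkew a N` implies `NormSkewBelow a N`. -/
lemma normSkewBelow_of_normSkew {a : ℕ → ℕ} {N : ℕ} (h : NormSkew a N) : NormSkewBelow a N :=
  fun i j hij hR => h i j hij (by omega)

/-- `NormSkewBelow a (N + 1)` implies `NormSkew a N` (the ratio lemma). -/
lemma normSkew_of_normSkewBelow_succ {a : ℕ → ℕ} {N : ℕ} (h : NormSkewBelow a (N + 1)) : NormSkew a N := by
  have := normSkew_of_cumNorm (N := N + 1) fun i j hij hR => h i j hij hR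
  simpa using this

/-- `NormSkewBelow` is monotone in the parameter. -/
lemma normSkewBelow_mono {a : ℕ → ℕ} {N N' : ℕ} (h : NormSkewBelow a N) (hN : N' ≤ N) : NormSkewBelow a N' := by
  intro i j hij hR
  have h1 := h i j hij (by omega)
  have h2 : N.choose i * N'.choose j ≤ N.choose j * N'.choose i := chooseRatio_le hN hij.le (by omega)
  have hpos : 0 < N.choose i := Nat.choose_pos (by omega)
  refine Nat.le_of_mul_le_mul_left (c := N.choose i) ?_ hpos
  calc N.choose i * (a i * N'.choose j) = a i * (N.choose i * N'.choose j) := by ring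
    _ ≤ a i * (N.choose j * N'.choose i) := Nat.mul_le_mul_left _ h2
    _ = (a i * N.choose j) * N'.choose i := by ring
    _ ≤ (a j * N.choose i) * N'.choose i := Nat.mul_le_mul_right _ h1
    _ = N.choose i * (a j * N'.choose i) := by ring

/-- `NormSkewBelow` is closed under pointwise sums. -/
lemma normSkewBelow_add {v w : ℕ → ℕ} {N : ℕ} (hv : NormSkewBelow v N) (hw : NormSkewBelow w N) :
    NormSkewBelow (fun k => v k + w k) N := by
  intro i j hij hR
  have := Nat.add_le_add (hv i j hij hR) (hw i j hij hR)
  simp only [Nat.add_mul] at this ⊢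
  exact this

/-- `NormSkewBelow` only depends on the values at indices `< N`. -/
lemma normSkewBelow_congr {v w : ℕ → ℕ} {N : ℕ} (h : NormSkewBelow v N) (hvw : ∀ k, k < N → v k = w k) :
    NormSkewBelow w N := by
  intro i j hij hR
  rw [← hvw i (by omega), ← hvw j (by omega)]
  exact h i j hij hR

/-- **A shift by one adds two** to the parameter of `NormSkewBelow`. -/
lemma normSkewBelow_shift_one {a : ℕ → ℕ} {N : ℕ} (ha : NormSkewBelow a N) :
    NormSkewBelow (shiftSeq a 1) (N + 2) := by
  intro i j hij hR
  unfold shiftSeq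
  rcases Nat.eq_zero_or_pos i with hi0 | hi1
  · subst hi0
    rw [if_neg (by omega), Nat.zero_mul]
    exact Nat.zero_le _
  rw [if_pos (by omega), if_pos (by omega)]
  have hna := ha (i - 1) (j - 1) (by omega) (by omega)
  have hjN : j ≤ N + 1 := by omega
  have hpos : 0 < i * (N + 2 - i) * (j * (N + 2 - j)) :=
    Nat.mul_pos (Nat.mul_pos hi1 (by omega)) (Nat.mul_pos (by omega) (by omega))
  refine Nat.le_of_mul_le_mul_right (c := i * (N + 2 - i) * (j * (N + 2 - j))) ?_ hpos
  have c1 := choose_two_succ_mul N j (by omega)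
  have c2 := choose_two_succ_mul N i hi1
  have hle := mul_sub_le_mul_sub (N := N) hij.le (by omega)
  calc a (i - 1) * (N + 2).choose j * (i * (N + 2 - i) * (j * (N + 2 - j)))
      = a (i - 1) * ((N + 2).choose j * j * (N + 2 - j)) * (i * (N + 2 - i)) := by ring
    _ = a (i - 1) * (N.choose (j - 1) * ((N + 2) * (N + 1))) * (i * (N + 2 - i)) := by rw [c1]
    _ = (a (i - 1) * N.choose (j - 1)) * ((N + 2) * (N + 1)) * (i * (N + 2 - i)) := by ring
    _ ≤ (a (j - 1) * N.choose (i - 1)) * ((N + 2) * (N + 1)) * (j * (N + 2 - j)) :=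
        Nat.mul_le_mul (Nat.mul_le_mul_right _ hna) hle
    _ = a (j - 1) * (N.choose (i - 1) * ((N + 2) * (N + 1))) * (j * (N + 2 - j)) := by ring
    _ = a (j - 1) * ((N + 2).choose i * i * (N + 2 - i)) * (j * (N + 2 - j)) := by rw [c2]
    _ = a (j - 1) * (N + 2).choose i * (i * (N + 2 - i) * (j * (N + 2 - j))) := by ring

/-- **A shift by `t` adds `2t`** to the parameter of `NormSkewBelow`. -/
lemma normSkewBelow_shift {a : ℕ → ℕ} {N : ℕ} (ha : NormSkewBelow a N) (t : ℕ) :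
    NormSkewBelow (shiftSeq a t) (N + 2 * t) := by
  induction t with
  | zero =>
    refine normSkewBelow_congr ha fun k _ => ?_
    unfold shiftSeq
    rw [if_pos (Nat.zero_le k), Nat.sub_zero]
  | succ t ih =>
    have h1 := normSkewBelow_shift_one ih
    rw [show N + 2 * (t + 1) = N + 2 * t + 2 by ring]
    exact normSkewBelow_congr h1 fun k _ => (shiftSeq_succ a t k).symm

end SkewConv

open Set Matroid

variable {α : Type} (M : Matroid α) [M.Finite]

/-- **(CUM-norm) in the level index**: the contain-`X` profile of a (CUM-norm) matroid satisfies
`NormSkewBelow (·) #E` (the `j`-indexed statement with parameter `#E − 2#X`, shifted by `#X`). -/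
lemma normSkewBelow_biContainCount_of_normSkew (h : BiContainNormSkew M) {X : Set α} (hX : X ⊆ M.E) :
    SkewConv.NormSkewBelow (fun k => biContainCount M X k) M.E.ncard := by
  have hXE : X.ncard ≤ M.E.ncard := Set.ncard_le_ncard hX M.ground_finite
  have hj : SkewConv.NormSkewBelow (fun i => minorPairCount M X ∅ i) (M.E.ncard - 2 * X.ncard) := by
    intro i j hij hR
    have := h X hX i j hij hR
    have hi := biContainCount_eq_minorPairCount M hX (k := X.ncard + i) (by omega)
    have hj' := biContainCount_eq_minorPairCount M hX (k := X.ncard + j) (by omega)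
    rw [Nat.add_sub_cancel_left] at hi hj'
    rw [hi, hj'] at this
    exact this
  have hs := SkewConv.normSkewBelow_shift hj X.ncard
  refine SkewConv.normSkewBelow_congr (SkewConv.normSkewBelow_mono hs (by omega)) fun k _ => ?_
  unfold SkewConv.shiftSeq
  split_ifs with hk
  · exact (biContainCount_eq_minorPairCount M hX hk).symm
  · exact (biContainCount_eq_zero_of_lt_ncard M (by omega)).symm

/-- **The absorbing part at a non-loop `y ∈ Y₂` is fully normalized-skew with parameter `#E − b − 1`**
(`#Y₂ = b + 1`), given the sharp statement `NormSkewBelow (·) (#E′ − b)` for the minors `(N ／ {y}) ＼ {x}`: each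
fibre is such a family shifted by one level, hence `NormSkewBelow (·) (#E − b)`, hence `NormSkew (·) (#E − b − 1)`. -/
lemma mixedAbsorb_normSkew_sharp {N : Matroid α} [N.Finite] {y : α} (hy : N.Indep {y}) {Y₁ Y₂ : Set α}
    (hY₁ : Y₁ ⊆ N.E) (hY₂ : Y₂ ⊆ N.E) (hyY : y ∈ Y₂) (hd : Disjoint Y₁ Y₂) {b : ℕ} (hb : Y₂.ncard = b + 1)
    (ih : ∀ (N' : Matroid α) [N'.Finite], Matroid.IsMinor N' N → ∀ Y₁' Y₂' : Set α, Y₁' ⊆ N'.E → Y₂' ⊆ N'.E →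
      Y₂'.ncard = b → SkewConv.NormSkewBelow (fun k => mixedCount N' Y₁' Y₂' k) (N'.E.ncard - b)) :
    SkewConv.NormSkew (fun k => (mixedAbsorb N Y₁ Y₂ y k).ncard) (N.E.ncard - b - 1) := by
  classical
  have hyE : y ∈ N.E := hY₂ hyY
  have hY₂' : (Y₂ \ {y}).ncard = b := by
    rw [Set.ncard_sdiff_singleton_of_mem hyY, hb]
    rfl
  have hcirc : ∀ C ∈ circuitsThroughAt N y,
      SkewConv.NormSkew (fun k => (mixedFibre N Y₁ Y₂ y C k).ncard) (N.E.ncard - b - 1) := by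
    intro C hC
    rw [mem_circuitsThroughAt] at hC
    by_cases hsub : C \ {y} ⊆ Y₂
    · refine SkewConv.normSkew_congr (SkewConv.normSkew_zero _) fun k _ => ?_
      rw [mixedFibre_eq_empty_of_subset N hC.1 hC.2 hy hsub k, Set.ncard_empty]
    · obtain ⟨x, hxC', hxY⟩ : ∃ x ∈ C \ {y}, x ∉ Y₂ := by
        by_contra hcon
        push Not at hcon
        exact hsub fun z hz => hcon z hz
      have hxC : x ∈ C := hxC'.1
      have hxy : x ≠ y := fun hh => hxC'.2 (Set.mem_singleton_iff.mpr hh)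
      have hxE : x ∈ N.E := hC.1.subset_ground hxC
      set N' := (N.contract {y}).delete {x} with hN'
      have hN'min : Matroid.IsMinor N' N := ⟨{y}, {x}, rfl⟩
      haveI : N'.Finite := ⟨N.ground_finite.subset hN'min.subset⟩
      have hx' : x ∈ N.E \ {y} := ⟨hxE, fun hh => hxy (Set.mem_singleton_iff.mp hh)⟩
      have hN'card : N'.E.ncard = N.E.ncard - 2 := by
        rw [hN', minor_ground_eq', Set.ncard_sdiff_singleton_of_mem hx', Set.ncard_sdiff_singleton_of_mem hyE]
        omega
      have hyY₁ : y ∉ Y₁ := fun hh => (Set.disjoint_left.mp hd) hh hyY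
      have hY₁'' : (Y₁ ∪ (C \ {y})) \ {x} ⊆ N'.E := by
        rw [hN', minor_ground_eq']
        rintro z ⟨hz, hzx⟩
        refine ⟨⟨?_, ?_⟩, hzx⟩
        · rcases hz with hz | hz
          · exact hY₁ hz
          · exact hC.1.subset_ground hz.1
        · rcases hz with hz | hz
          · exact fun hzy => hyY₁ (Set.mem_singleton_iff.mp hzy ▸ hz)
          · exact hz.2
      have hY₂'' : Y₂ \ {y} ⊆ N'.E := by
        rw [hN', minor_ground_eq']
        rintro z ⟨hz, hzy⟩
        exact ⟨⟨hY₂ hz, hzy⟩, fun hzx => hxY (Set.mem_singleton_iff.mp hzx ▸ hz)⟩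
      have hW := ih N' hN'min _ _ hY₁'' hY₂'' hY₂'
      rw [hN'card] at hW
      have hshift := SkewConv.normSkewBelow_shift_one hW
      -- `NormSkewBelow (·) ((#E − 2 − b) + 2)` gives `NormSkew (·) (#E − b − 1)` when `#E ≥ b + 2`, else vacuous
      have hfull : SkewConv.NormSkew (SkewConv.shiftSeq (fun k => mixedCount N' ((Y₁ ∪ (C \ {y})) \ {x})
          (Y₂ \ {y}) k) 1) (N.E.ncard - b - 1) := by
        rcases Nat.lt_or_ge (N.E.ncard) (b + 2) with hsmall | hbig
        · intro i j hij hR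
          omega
        · have e : N.E.ncard - 2 - b + 2 = N.E.ncard - b - 1 + 1 := by omega
          rw [e] at hshift
          exact SkewConv.normSkew_of_normSkewBelow_succ hshift
      refine SkewConv.normSkew_congr hfull fun k _ => ?_
      rcases k with _ | i
      · simp only [SkewConv.shiftSeq]
        rw [if_neg (by omega), mixedFibre_zero_eq_empty N hC.1 hC.2 hy, Set.ncard_empty]
      · simp only [SkewConv.shiftSeq, Nat.succ_le_succ_iff, Nat.zero_le, if_true, Nat.add_sub_cancel]
        exact (ncard_mixedFibre_eq N hC.1 hC.2 hxC hxy hy hxY i).symm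
  have hsum := SkewConv.normSkew_sum (circuitsThroughAt N y) (fun C k => (mixedFibre N Y₁ Y₂ y C k).ncard) hcirc
  exact SkewConv.normSkew_congr hsum fun k _ => (ncard_mixedAbsorb_eq_sum N hyE hyY k).symm

omit [M.Finite] in
/-- **THE SHARP PER-SET LADDER** (induction on `#Y₂`, for all minors simultaneously): under (CUM-norm) on the
minors of `M`, for every minor `N` and `Y₁, Y₂ ⊆ E(N)` with `#Y₂ = b`: `NormSkewBelow (q^{Y₁,Y₂}) (#E(N) − b)`, and
`NormSkew (q^{∅,Y₂}) (#E(N) − b)`. -/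
theorem mixedCount_normSkewBelow_aux (h : ∀ N : Matroid α, Matroid.IsMinor N M → BiContainNormSkew N) :
    ∀ (b : ℕ) (N : Matroid α) [N.Finite], Matroid.IsMinor N M → ∀ Y₁ Y₂ : Set α, Y₁ ⊆ N.E → Y₂ ⊆ N.E →
      Y₂.ncard = b →
      SkewConv.NormSkewBelow (fun k => mixedCount N Y₁ Y₂ k) (N.E.ncard - b) ∧
      SkewConv.NormSkew (fun k => mixedCount N ∅ Y₂ k) (N.E.ncard - b) := by
  intro b
  induction b with
  | zero =>
    intro N _ hNM Y₁ Y₂ hY₁ hY₂ hb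
    have hY₂e : Y₂ = ∅ := (Set.ncard_eq_zero (N.ground_finite.subset hY₂)).mp hb
    subst hY₂e
    constructor
    · rw [Nat.sub_zero]
      refine SkewConv.normSkewBelow_congr (normSkewBelow_biContainCount_of_normSkew N (h N hNM) hY₁)
        fun k _ => ?_
      exact (mixedCount_empty_right N Y₁ k).symm
    · rw [Nat.sub_zero]
      have hmono : BiIndepMono N :=
        biIndepMono_of_forall_minor_normSkew N fun N' hN' => h N' (hN'.trans hNM)
      refine SkewConv.normSkew_congr (normSkew_biIndepCount_of_mono N hmono) fun k _ => ?_
      rw [mixedCount_empty_right, biContainCount_empty]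
  | succ b ih =>
    intro N _ hNM Y₁ Y₂ hY₁ hY₂ hb
    obtain ⟨y, hyY⟩ := Set.nonempty_of_ncard_ne_zero (by omega : Y₂.ncard ≠ 0)
    have hyE : y ∈ N.E := hY₂ hyY
    have hY₂' : (Y₂ \ {y}).ncard = b := by
      rw [Set.ncard_sdiff_singleton_of_mem hyY, hb]
      rfl
    by_cases hy : N.Indep {y}
    · have hynl : N.IsNonloop y := Matroid.indep_singleton.mp hy
      have hcmin : Matroid.IsMinor (N.contract {y}) N := ⟨{y}, ∅, (Matroid.delete_empty _).symm⟩
      haveI : (N.contract {y}).Finite := ⟨N.ground_finite.subset hcmin.subset⟩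
      have hccard : (N.contract {y}).E.ncard = N.E.ncard - 1 := by
        rw [Matroid.contract_ground, Set.ncard_sdiff_singleton_of_mem hyE]
      have hY₂c : Y₂ \ {y} ⊆ (N.contract {y}).E := by
        rw [Matroid.contract_ground]
        exact Set.sdiff_subset_sdiff_left hY₂
      have ihW : ∀ (N' : Matroid α) [N'.Finite], Matroid.IsMinor N' N → ∀ Y₁' Y₂' : Set α, Y₁' ⊆ N'.E →
          Y₂' ⊆ N'.E → Y₂'.ncard = b →
          SkewConv.NormSkewBelow (fun k => mixedCount N' Y₁' Y₂' k) (N'.E.ncard - b) :=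
        fun N' _ hN' Y₁' Y₂' h1 h2 h3 => (ih N' (hN'.trans hNM) Y₁' Y₂' h1 h2 h3).1
      constructor
      · by_cases hd : Disjoint Y₁ Y₂
        · have hyY₁ : y ∉ Y₁ := fun hh => (Set.disjoint_left.mp hd) hh hyY
          have hY₁c : Y₁ ⊆ (N.contract {y}).E := by
            rw [Matroid.contract_ground]
            exact fun z hz => ⟨hY₁ hz, fun hzy => hyY₁ (Set.mem_singleton_iff.mp hzy ▸ hz)⟩
          have hfree := (ih (N.contract {y}) (hcmin.trans hNM) Y₁ (Y₂ \ {y}) hY₁c hY₂c hY₂').1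
          rw [hccard] at hfree
          have habs := mixedAbsorb_normSkew_sharp hy hY₁ hY₂ hyY hd hb ihW
          have hsum : SkewConv.NormSkewBelow
              (fun k => mixedCount (N.contract {y}) Y₁ (Y₂ \ {y}) k + (mixedAbsorb N Y₁ Y₂ y k).ncard)
              (N.E.ncard - (b + 1)) :=
            SkewConv.normSkewBelow_add (SkewConv.normSkewBelow_mono hfree (by omega))
              (SkewConv.normSkewBelow_mono (SkewConv.normSkewBelow_of_normSkew habs) (by omega))
          refine SkewConv.normSkewBelow_congr hsum fun k _ => ?_
          rw [mixedCount_eq_free_add_absorb N Y₁ Y₂ y k, mixedFree_eq_contract N hynl hyY k]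
          rfl
        · exact SkewConv.normSkewBelow_congr (SkewConv.normSkewBelow_of_normSkew (SkewConv.normSkew_zero _))
            fun k _ => (mixedCount_eq_zero_of_not_disjoint N hd k).symm
      · have hfree := (ih (N.contract {y}) (hcmin.trans hNM) ∅ (Y₂ \ {y}) (Set.empty_subset _) hY₂c hY₂').2
        rw [hccard] at hfree
        have habs := mixedAbsorb_normSkew_sharp hy (Set.empty_subset _) hY₂ hyY (Set.empty_disjoint _) hb ihW
        have hsum : SkewConv.NormSkew
            (fun k => mixedCount (N.contract {y}) ∅ (Y₂ \ {y}) k + (mixedAbsorb N ∅ Y₂ y k).ncard)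
            (N.E.ncard - (b + 1)) :=
          SkewConv.normSkew_add (SkewConv.normSkew_mono hfree (by omega))
            (SkewConv.normSkew_mono habs (by omega))
        refine SkewConv.normSkew_congr hsum fun k _ => ?_
        rw [mixedCount_eq_free_add_absorb N ∅ Y₂ y k, mixedFree_eq_contract N hynl hyY k]
        rfl
    · constructor
      · exact SkewConv.normSkewBelow_congr (SkewConv.normSkewBelow_of_normSkew (SkewConv.normSkew_zero _))
          fun k _ => (mixedCount_eq_zero_of_loop N hyE hy Y₁ Y₂ k).symm
      · exact SkewConv.normSkew_congr (SkewConv.normSkew_zero _) fun k _ =>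
          (mixedCount_eq_zero_of_loop N hyE hy ∅ Y₂ k).symm

/-- **(CUM-norm) FOR MIXED PROFILES, FROM (CUM-norm) ON THE MINORS**: for every `Y₁, Y₂ ⊆ E`,
`q_i · C(#E − #Y₂, j) ≤ q_j · C(#E − #Y₂, i)` for `i < j`, `i + j + 1 ≤ #E − #Y₂` (level index). -/
theorem mixedCount_normSkewBelow (h : ∀ N : Matroid α, Matroid.IsMinor N M → BiContainNormSkew N)
    {Y₁ Y₂ : Set α} (hY₁ : Y₁ ⊆ M.E) (hY₂ : Y₂ ⊆ M.E) :
    SkewConv.NormSkewBelow (fun k => mixedCount M Y₁ Y₂ k) (M.E.ncard - Y₂.ncard) :=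
  (mixedCount_normSkewBelow_aux M h Y₂.ncard M Matroid.IsMinor.refl Y₁ Y₂ hY₁ hY₂ rfl).1

end PercRepro
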